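import Literature.Probability.RandomPlanarGeometry.HexSAWRotSurfaceYcLimitAllY
import Literature.Probability.RandomPlanarGeometry.HexSAWRotSurfaceDensity
import Mathlib.Analysis.Calculus.Deriv.Slope
import HarnessLib

/-!
# Beaton's rotated honeycomb surface — the mean density of surface vertices IN THE LIMIT of long walks:
# `density_n(y) → y·μ′(y)/μ(y)` (the exchange of `lim_n` and `∂/∂ log y`), positive for every `y > y_c` eventually

Topic `Literature/Probability/RandomPlanarGeometry` (lane «pcv-sawmu», rotated-door lineage; continues `HexSAWRotSurfaceDensity.lean`
— the finite-`n` vocabulary `rotSurfMoment n y = Σ_γ m(γ) y^{m(γ)}`, **`rotSurfDensity n y = rotSurfMoment n y / (n · C⁺_n(y))`** (the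
printed mean density), the chord inequality `rpow_rotSurfDensity_le`, `tendsto_rotSurfDensity_zero` below `y_c`,
`frequently_le_rotSurfDensity_of_gt` / `eventually_le_rotSurfDensity_of_rate` above — whose header lists as NOT DECIDED «the existence of
the limit density `y ∂ log μ(y)/∂y` (it needs `μ(y) = lim C⁺_n(y)^{1/n}` for `y > y_c` …)»; that limit is now the tree's
`HexSAWRotSurfaceYcLimitAllY.lean`: **`tendsto_rotHpCoeff_rpow (0 < y) : C⁺_n(y)^{1/n} → rotSurfaceMu y`** for EVERY `y > 0`, with
`rotSurfaceMu_eq_iff : μ(y) = μ ↔ y ≤ y†`, `hexConnectiveConstant_lt_rotSurfaceMu_iff`, `rotSurfaceMu_mono`; and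
`HexSAWRotSurfaceArmchairDictionary.lean`'s `rotGrowthGeRate_rotSurfaceMu (0 < y) : RotGrowthGeRate y (rotSurfaceMu y)`).
It is the ROTATED twin of the zig-zag-frame rider «DENSITY-LIMIT» `HexSAWSurfaceDensityLimit.lean` (a-idea-1 g21/g25, HOME), by the
same secant argument, written so as to need NO convexity or differentiability facts about the limit `μ(y)` beyond monotonicity.

Source.  N. R. Beaton, *The critical surface fugacity of self-avoiding walks on a rotated honeycomb lattice*, J. Phys. A 47 (2014)
075003 = arXiv:1210.0274v3, §3.1, the last paragraph (arXiv v3 **p. 14**; Proposition 7 itself p. 11): "A quantity of much interest is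
the mean density of vertices in the surface, given by `(1/n) Σ_m m c^+_n(m) y^m / Σ_m c_n^+(m) y^m = (y/n) ∂ log C^+_n(y)/∂y`. In the
limit of infinitely long walks, this density tends to² `y ∂ log μ(y)/∂y`. From the behaviour of `μ(y)` given in Proposition 7, it
can be seen that the density of vertices in the surface is `0` for `y < y_c` and is positive for `y > y_c`."  (footnote 2, arXiv v3
p. 14: "The exchange of the limit and the derivative is possible thanks to the convexity of log μ(y), see for instance [16, Thm. B7]"
— [16] = Janse van Rensburg 2000; the same footnote is BBdGDCG14's footnote 4, arXiv v5 p. 10, citing [26, Thm. B7, p. 345].)  Here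
`y_c = rotYdagger` (`= hexRotSurfaceYc`, Beaton's Theorem 1, tree `HexSAWRotSurfaceYc.lean`).

## What is proved (namespace `Literature.Probability.RandomPlanarGeometry.SAW.HV`; no hypotheses beyond `0 < y`)

* `eventually_rotHpCoeff_pos (0 < y)` (`C⁺_n(y) > 0` for all large `n`, from the eventual lower rate `μ`),
  **`tendsto_log_rotHpCoeff_div (0 < y) : (1/n) log C⁺_n(y) → log μ(y)`** — the free energy per vertex exists (logarithmic form of
  Proposition 7's first sentence);
* `mul_rotSurfDensity_mul_log_le` — the chord inequality of `HexSAWRotSurfaceDensity` in logarithmic form: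
  `n · density_n(y) · log (y₀/y) ≤ log C⁺_n(y₀) − log C⁺_n(y)` (convexity of `log C⁺_n ∘ exp`), `rotSurfDensity_mul_sub_le` (the same in the
  parametrisation `y = eᵗ`, divided by `n`), `tendsto_rotSecant` (secants of `(1/n) log C⁺_n ∘ exp` converge to secants of `log μ ∘ exp`),
  `eventually_rotSurfDensity_lt` / `eventually_lt_rotSurfDensity` (right secants bound the density from above, left secants from below,
  eventually in `n`);
* **`tendsto_rotSurfDensity_exp`: if `s ↦ log μ(eˢ)` has derivative `d` at `t`, then `density_n(eᵗ) → d`** — THE EXCHANGE OF THE LIMIT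
  AND THE DERIVATIVE of the printed sentence; `tendsto_rotSurfDensity_of_hasDerivAt_log` (`y`-form);
  **`tendsto_rotSurfDensity (0 < y) (DifferentiableAt ℝ rotSurfaceMu y) : density_n(y) → y · μ′(y)/μ(y)`** («this density tends to
  `y ∂ log μ(y)/∂y`»), and **`ae_tendsto_rotSurfDensity`**: so for almost every `y > 0` (`μ(·)` is non-decreasing, hence a.e.
  differentiable — Lebesgue);
* the two phases: `hasDerivAt_log_rotSurfaceMu_exp_zero` (`t < log y†`: `s ↦ log μ(eˢ)` is locally constant `= log μ`, derivative `0`) and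
  `tendsto_rotSurfDensity_exp_zero_of_lt` (limit `0` below `y_c`, here via the derivative; the parent proves the same limit by
  exponential tails, `tendsto_rotSurfDensity_zero`);  **`eventually_le_rotSurfDensity_of_gt (y† < y) : ∃ δ > 0, ∀ᶠ n, δ ≤ density_n(y)`**
  for EVERY `y > y_c` — the parent's `frequently_le_rotSurfDensity_of_gt` upgraded from "infinitely often" to "eventually", now that
  `μ(y) > μ` is an EVENTUAL lower rate at every `y > y†`; `limit_rotSurfDensity_pos_of_gt` (hence any limit of the densities at
  `y > y_c` is `≥ δ > 0`) and **`tendsto_rotSurfDensity_pos_of_gt (y† < y) (DifferentiableAt ℝ rotSurfaceMu y) :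
  0 < y·μ′(y)/μ(y) ∧ density_n(y) → y·μ′(y)/μ(y)`** («is positive for `y > y_c`», wherever `μ` is differentiable, i.e. a.e.).

LABEL (author's proposal): CONSOLIDATION AS PRINTED of Beaton 2014 §3.1's density paragraph (p. 14) — the exchange of limit and derivative
(the footnote) machine-checked for the rotated frame; the eventual positivity for every `y > y_c` is the lane's finite-`n` sharpening (XS).
Not claimed: existence of the limit density AT `y_c` or at the (at most countably many) fugacities where `μ` is not differentiable;
the sandwich `ρ⁻ ≤ liminf ≤ limsup ≤ ρ⁺` by one-sided derivatives (it needs the log-convexity of `μ(·)`, filed separately).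
-/

noncomputable section

open Finset Filter Function
open _root_.Topology

namespace Literature.Probability.RandomPlanarGeometry.SAW.HV

variable {y : ℝ}

/-! ### The free energy per vertex and the chord inequality -/

/-- `C⁺_n(y) > 0` at one positive fugacity gives it at every positive fugacity (it is a sum of positive powers over the same finite
set of walks). [cite: Beaton2014RotatedHoneycomb, §3.1 (arXiv v3 p. 11: "C_n^+(y) = Σ_m c_n^+(m) y^m")] -/
theorem rotHpCoeff_pos_of_pos {n : ℕ} {y y' : ℝ} (hy' : 0 < y') (h : 0 < rotHpCoeff n y) : 0 < rotHpCoeff n y' := by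
  have hne : (rotHpWalks n).Nonempty := by
    by_contra hemp
    rw [Finset.not_nonempty_iff_eq_empty] at hemp
    rw [rotHpCoeff, hemp, sum_empty] at h
    exact lt_irrefl _ h
  rw [rotHpCoeff]
  exact sum_pos (fun l _ => pow_pos hy' _) hne

/-- **Eventually `C⁺_n(y) > 0`** (`y > 0`): `C⁺_n(y) ≥ rⁿ` eventually for every `r < μ` (`rotGrowthGeRate_mu_of_pos`).
[cite: Beaton2014RotatedHoneycomb, §3.1, Proposition 7 (arXiv v3 p. 11: "μ(y) ≥ max{μ, √y}")] -/
theorem eventually_rotHpCoeff_pos (hy : 0 < y) : ∀ᶠ n : ℕ in atTop, 0 < rotHpCoeff n y := by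
  have hμ0 : 0 < hexConnectiveConstant := by
    rw [hexConnectiveConstant_eq_inv]; exact inv_pos.2 hexCriticalFugacity_pos_lt_one.1
  have hr0 : (0 : ℝ) < hexConnectiveConstant / 2 := by positivity
  filter_upwards [rotGrowthGeRate_mu_of_pos hy (hexConnectiveConstant / 2) hr0.le (by linarith)] with n hn
  exact (pow_pos hr0 n).trans_le hn

/-- **`(1/n)·log C⁺_n(y) → log μ(y)`** — the surface free energy per vertex exists, for every `y > 0` (logarithmic form of
Proposition 7's first sentence, `tendsto_rotHpCoeff_rpow`). [cite: Beaton2014RotatedHoneycomb, §3.1, Proposition 7 (arXiv v3 p. 11: "μ(y) := lim C_n^+(y)^{1/n} exists and is finite")] -/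
theorem tendsto_log_rotHpCoeff_div (hy : 0 < y) :
    Tendsto (fun n : ℕ => Real.log (rotHpCoeff n y) / n) atTop (𝓝 (Real.log (rotSurfaceMu y))) := by
  have h := tendsto_rotHpCoeff_rpow hy
  have hlog := ((Real.continuousAt_log (rotSurfaceMu_pos y).ne').tendsto).comp h
  refine hlog.congr' ?_
  filter_upwards [eventually_rotHpCoeff_pos hy] with n hn
  simp only [Function.comp]
  rw [Real.log_rpow hn, inv_mul_eq_div]

/-- **Chord inequality, logarithmic form** (convexity of `t ↦ log C⁺_n(eᵗ)`): for `y, y₀ > 0`, `n ≥ 1` and `C⁺_n(y) > 0`,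
`n · density_n(y) · log (y₀/y) ≤ log C⁺_n(y₀) − log C⁺_n(y)` (the parent's `rpow_rotSurfDensity_le` after taking logarithms).
[cite: Beaton2014RotatedHoneycomb, §3.1, last paragraph (arXiv v3 p. 14: "(y/n) ∂ log C^+_n(y)/∂y")] -/
theorem mul_rotSurfDensity_mul_log_le (hy : 0 < y) {y₀ : ℝ} (hy₀ : 0 < y₀) {n : ℕ} (hn : 1 ≤ n) (hC : 0 < rotHpCoeff n y) :
    (n : ℝ) * rotSurfDensity n y * Real.log (y₀ / y) ≤ Real.log (rotHpCoeff n y₀) - Real.log (rotHpCoeff n y) := by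
  have hC₀ : 0 < rotHpCoeff n y₀ := rotHpCoeff_pos_of_pos hy₀ hC
  have hq : 0 < y₀ / y := div_pos hy₀ hy
  have hn0 : (n : ℝ) ≠ 0 := by exact_mod_cast Nat.one_le_iff_ne_zero.1 hn
  have key := rpow_rotSurfDensity_le hy hy₀ hC
  have hlog := Real.log_le_log (Real.rpow_pos_of_pos hq _) key
  rw [Real.log_rpow hq, Real.log_div hC₀.ne' hC.ne'] at hlog
  have hE : (n : ℝ) * rotSurfDensity n y = rotSurfMoment n y / rotHpCoeff n y := by
    simp only [rotSurfDensity]; field_simp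
  rw [hE]; exact hlog

/-- Chord inequality in the `eᵗ` parametrisation, divided by `n`:
`density_n(eᵗ) · (t' − t) ≤ (1/n) log C⁺_n(e^{t'}) − (1/n) log C⁺_n(eᵗ)` (`n ≥ 1`, `C⁺_n > 0`).
[cite: Beaton2014RotatedHoneycomb, §3.1, last paragraph (arXiv v3 p. 14); step of the secant argument] -/
theorem rotSurfDensity_mul_sub_le (t t' : ℝ) {n : ℕ} (hn : 1 ≤ n) (hC : 0 < rotHpCoeff n (Real.exp t)) :
    rotSurfDensity n (Real.exp t) * (t' - t) ≤
      Real.log (rotHpCoeff n (Real.exp t')) / n - Real.log (rotHpCoeff n (Real.exp t)) / n := by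
  have hn0 : (0 : ℝ) < n := by exact_mod_cast hn
  have h := mul_rotSurfDensity_mul_log_le (Real.exp_pos t) (Real.exp_pos t') hn hC
  rw [← Real.exp_sub, Real.log_exp] at h
  rw [← sub_div, le_div_iff₀ hn0]
  calc rotSurfDensity n (Real.exp t) * (t' - t) * n = n * rotSurfDensity n (Real.exp t) * (t' - t) := by ring
    _ ≤ _ := h

/-- Secants of `(1/n) log C⁺_n ∘ exp` converge to secants of `log μ ∘ exp`.
[cite: Beaton2014RotatedHoneycomb, §3.1, Proposition 7 and last paragraph (arXiv v3 pp. 11, 14); step of the secant argument] -/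
theorem tendsto_rotSecant (t t' : ℝ) :
    Tendsto (fun n : ℕ => (Real.log (rotHpCoeff n (Real.exp t')) / n - Real.log (rotHpCoeff n (Real.exp t)) / n) / (t' - t))
      atTop (𝓝 ((Real.log (rotSurfaceMu (Real.exp t')) - Real.log (rotSurfaceMu (Real.exp t))) / (t' - t))) :=
  ((tendsto_log_rotHpCoeff_div (Real.exp_pos t')).sub (tendsto_log_rotHpCoeff_div (Real.exp_pos t))).div_const _

/-- **Right secants bound the density from above, eventually**: if `t < t'` and the secant slope of `log μ ∘ exp` over `[t, t']` is
`< b`, then `density_n(eᵗ) < b` for all large `n`. [cite: Beaton2014RotatedHoneycomb, §3.1, last paragraph (arXiv v3 p. 14); step of the secant argument] -/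
theorem eventually_rotSurfDensity_lt {t t' b : ℝ} (htt' : t < t')
    (hb : (Real.log (rotSurfaceMu (Real.exp t')) - Real.log (rotSurfaceMu (Real.exp t))) / (t' - t) < b) :
    ∀ᶠ n : ℕ in atTop, rotSurfDensity n (Real.exp t) < b := by
  have hgt : 0 < t' - t := sub_pos.2 htt'
  filter_upwards [(tendsto_rotSecant t t').eventually_lt_const hb, eventually_ge_atTop 1,
    eventually_rotHpCoeff_pos (Real.exp_pos t)] with n hn h1n hC
  exact lt_of_le_of_lt ((le_div_iff₀ hgt).2 (rotSurfDensity_mul_sub_le t t' h1n hC)) hn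

/-- **Left secants bound the density from below, eventually**: if `t' < t` and the secant slope of `log μ ∘ exp` over `[t', t]` is
`> a`, then `a < density_n(eᵗ)` for all large `n`. [cite: Beaton2014RotatedHoneycomb, §3.1, last paragraph (arXiv v3 p. 14); step of the secant argument] -/
theorem eventually_lt_rotSurfDensity {t t' a : ℝ} (ht't : t' < t)
    (ha : a < (Real.log (rotSurfaceMu (Real.exp t')) - Real.log (rotSurfaceMu (Real.exp t))) / (t' - t)) :
    ∀ᶠ n : ℕ in atTop, a < rotSurfDensity n (Real.exp t) := by
  have hlt : t' - t < 0 := sub_neg.2 ht't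
  filter_upwards [(tendsto_rotSecant t t').eventually_const_lt ha, eventually_ge_atTop 1,
    eventually_rotHpCoeff_pos (Real.exp_pos t)] with n hn h1n hC
  exact hn.trans_le ((div_le_iff_of_neg hlt).2 (rotSurfDensity_mul_sub_le t t' h1n hC))

/-! ### The exchange of `lim_n` and `∂/∂ log y` -/

/-- **The exchange of `lim_n` and `∂/∂ log y`** (the printed footnote): if `s ↦ log μ(eˢ)` has derivative `d` at `t`, then the mean
surface density of `n`-vertex walks at fugacity `y = eᵗ` converges to `d`.  Proof: by convexity of `log C⁺_n ∘ exp` the density lies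
between the left and right secant slopes of `(1/n) log C⁺_n ∘ exp`, which converge to those of `log μ ∘ exp` (Proposition 7's limit at
three fugacities); shrink the secants.
[cite: Beaton2014RotatedHoneycomb, §3.1, last paragraph (arXiv v3 p. 14: "In the limit of infinitely long walks, this density tends to y ∂ log μ(y)/∂y"); HammersleyTorrieWhittington1982, §3] -/
theorem tendsto_rotSurfDensity_exp {t d : ℝ}
    (hd : HasDerivAt (fun s => Real.log (rotSurfaceMu (Real.exp s))) d t) :
    Tendsto (fun n : ℕ => rotSurfDensity n (Real.exp t)) atTop (𝓝 d) := by
  have hslope := hasDerivAt_iff_tendsto_slope.1 hd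
  have hq : ∀ t', slope (fun s => Real.log (rotSurfaceMu (Real.exp s))) t t'
      = (Real.log (rotSurfaceMu (Real.exp t')) - Real.log (rotSurfaceMu (Real.exp t))) / (t' - t) :=
    fun t' => slope_def_field _ t t'
  rw [tendsto_order]
  refine ⟨fun a ha => ?_, fun b hb => ?_⟩
  · have h1 : ∀ᶠ t' in 𝓝[<] t, a < slope (fun s => Real.log (rotSurfaceMu (Real.exp s))) t t' :=
      (hslope.mono_left (nhdsLT_le_nhdsNE t)).eventually_const_lt ha
    obtain ⟨t', ht'a, ht't⟩ := (h1.and eventually_mem_nhdsWithin).exists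
    rw [hq] at ht'a
    exact eventually_lt_rotSurfDensity ht't ht'a
  · have h1 : ∀ᶠ t' in 𝓝[>] t, slope (fun s => Real.log (rotSurfaceMu (Real.exp s))) t t' < b :=
      (hslope.mono_left (nhdsGT_le_nhdsNE t)).eventually_lt_const hb
    obtain ⟨t', ht'b, ht't⟩ := (h1.and eventually_mem_nhdsWithin).exists
    rw [hq] at ht'b
    exact eventually_rotSurfDensity_lt ht't ht'b

/-- `y`-form of `tendsto_rotSurfDensity_exp`: the density at `y > 0` converges to the derivative of `log μ ∘ exp` at `log y`.
[cite: Beaton2014RotatedHoneycomb, §3.1, last paragraph (arXiv v3 p. 14)] -/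
theorem tendsto_rotSurfDensity_of_hasDerivAt_log (hy : 0 < y) {d : ℝ}
    (hd : HasDerivAt (fun s => Real.log (rotSurfaceMu (Real.exp s))) d (Real.log y)) :
    Tendsto (fun n : ℕ => rotSurfDensity n y) atTop (𝓝 d) := by
  have h := tendsto_rotSurfDensity_exp hd
  rwa [Real.exp_log hy] at h

/-- **`density_n(y) → y·μ′(y)/μ(y)` wherever `μ` is differentiable** («In the limit of infinitely long walks, this density tends to
`y ∂ log μ(y)/∂y`»). [cite: Beaton2014RotatedHoneycomb, §3.1, last paragraph (arXiv v3 p. 14)] -/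
theorem tendsto_rotSurfDensity (hy : 0 < y) (hd : DifferentiableAt ℝ rotSurfaceMu y) :
    Tendsto (fun n : ℕ => rotSurfDensity n y) atTop (𝓝 (y * deriv rotSurfaceMu y / rotSurfaceMu y)) := by
  have h1 : HasDerivAt Real.exp (Real.exp (Real.log y)) (Real.log y) := Real.hasDerivAt_exp _
  have h2 : HasDerivAt rotSurfaceMu (deriv rotSurfaceMu y) (Real.exp (Real.log y)) := by
    rw [Real.exp_log hy]; exact hd.hasDerivAt
  have h3 : HasDerivAt (fun s => rotSurfaceMu (Real.exp s)) (deriv rotSurfaceMu y * Real.exp (Real.log y)) (Real.log y) :=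
    h2.comp _ h1
  have h4 := h3.log (rotSurfaceMu_pos _).ne'
  refine tendsto_rotSurfDensity_of_hasDerivAt_log hy (h4.congr_deriv ?_)
  simp only [Real.exp_log hy]
  ring

/-- **For almost every `y > 0` the surface density converges** (to `y μ′(y)/μ(y)`): `μ(·)` is non-decreasing on `(0, ∞)`
(`rotSurfaceMu_mono`), hence differentiable almost everywhere (Lebesgue).
[cite: Beaton2014RotatedHoneycomb, §3.1, Proposition 7 ("almost everywhere differentiable", arXiv v3 p. 11) and the last paragraph of §3.1 (p. 14)] -/
theorem ae_tendsto_rotSurfDensity : ∀ᵐ y : ℝ, 0 < y →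
    Tendsto (fun n : ℕ => rotSurfDensity n y) atTop (𝓝 (y * deriv rotSurfaceMu y / rotSurfaceMu y)) := by
  have hmono : MonotoneOn rotSurfaceMu (Set.Ioi 0) := fun _ hy _ _ hyy' => rotSurfaceMu_mono hy hyy'
  have hae := hmono.ae_differentiableWithinAt_of_mem
  filter_upwards [hae] with y hy hy0
  have hd : DifferentiableWithinAt ℝ rotSurfaceMu (Set.Ioi 0) y := hy hy0
  exact tendsto_rotSurfDensity hy0 (hd.differentiableAt (Ioi_mem_nhds hy0))

/-! ### The two phases in limit form -/

/-- **Desorbed phase: for `eᵗ < y†` the free energy `s ↦ log μ(eˢ)` is constant `= log μ` near `t`, so its derivative at `t` is `0`.**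
[cite: Beaton2014RotatedHoneycomb, §3.1, Proposition 7 (arXiv v3 p. 11: "μ(y) = μ if y ≤ y_c") and Theorem 1 (p. 2: y_c = y†)] -/
theorem hasDerivAt_log_rotSurfaceMu_exp_zero {t : ℝ} (ht : Real.exp t < rotYdagger) :
    HasDerivAt (fun s => Real.log (rotSurfaceMu (Real.exp s))) 0 t := by
  have hev : ∀ᶠ s in 𝓝 t, Real.log (rotSurfaceMu (Real.exp s)) = Real.log hexConnectiveConstant := by
    have hmem : Set.Iio (Real.log rotYdagger) ∈ 𝓝 t :=
      Iio_mem_nhds ((Real.lt_log_iff_exp_lt rotYdagger_pos).2 ht)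
    filter_upwards [hmem] with s hs
    have hs' : Real.exp s < rotYdagger := (Real.lt_log_iff_exp_lt rotYdagger_pos).1 hs
    rw [(rotSurfaceMu_eq_iff (Real.exp_pos s)).2 hs'.le]
  exact ((hasDerivAt_const t (Real.log hexConnectiveConstant)).congr_of_eventuallyEq hev)

/-- **Desorbed phase, limit form: for `0 < y < y†` the density tends to `0`** (here via the derivative; the parent file's
`tendsto_rotSurfDensity_zero` proves the same limit by exponential tails).
[cite: Beaton2014RotatedHoneycomb, §3.1, last paragraph (arXiv v3 p. 14: "the density of vertices in the surface is 0 for y < y_c")] -/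
theorem tendsto_rotSurfDensity_exp_zero_of_lt {t : ℝ} (ht : Real.exp t < rotYdagger) :
    Tendsto (fun n : ℕ => rotSurfDensity n (Real.exp t)) atTop (𝓝 0) :=
  tendsto_rotSurfDensity_exp (hasDerivAt_log_rotSurfaceMu_exp_zero ht)

/-- **Positive density above `y_c` for EVERY `y > y†`, eventual form**: there is `δ > 0` with `δ ≤ density_n(y)` for all large `n`
(the parent's `frequently_le_rotSurfDensity_of_gt` upgraded from "infinitely often" to "eventually": `μ(y) > μ` IS an eventual lower
rate at `y`, `rotGrowthGeRate_rotSurfaceMu` + `hexConnectiveConstant_lt_rotSurfaceMu_iff`, then the parent's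
`eventually_le_rotSurfDensity_of_rate`). [cite: Beaton2014RotatedHoneycomb, §3.1, last paragraph (arXiv v3 p. 14: "is positive for y > y_c")] -/
theorem eventually_le_rotSurfDensity_of_gt (hy : rotYdagger < y) :
    ∃ δ : ℝ, 0 < δ ∧ ∀ᶠ n : ℕ in atTop, δ ≤ rotSurfDensity n y := by
  have hy0 : 0 < y := rotYdagger_pos.trans hy
  exact eventually_le_rotSurfDensity_of_rate hy ((hexConnectiveConstant_lt_rotSurfaceMu_iff hy0).2 hy)
    (rotGrowthGeRate_rotSurfaceMu hy0)

/-- Above `y_c`, any limit of the densities is positive: if `density_n(y) → d` with `y > y†` then `0 < d`.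
[cite: Beaton2014RotatedHoneycomb, §3.1, last paragraph (arXiv v3 p. 14: "is positive for y > y_c")] -/
theorem limit_rotSurfDensity_pos_of_gt (hy : rotYdagger < y) {d : ℝ}
    (hd : Tendsto (fun n : ℕ => rotSurfDensity n y) atTop (𝓝 d)) : 0 < d := by
  obtain ⟨δ, hδ, hev⟩ := eventually_le_rotSurfDensity_of_gt hy
  exact hδ.trans_le (ge_of_tendsto hd hev)

/-- **Adsorbed phase, limit form**: for `y > y†` at which `μ` is differentiable (a.e.), the density tends to the POSITIVE number
`y μ′(y)/μ(y)`. [cite: Beaton2014RotatedHoneycomb, §3.1, last paragraph (arXiv v3 p. 14: "is positive for y > y_c")] -/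
theorem tendsto_rotSurfDensity_pos_of_gt (hy : rotYdagger < y) (hd : DifferentiableAt ℝ rotSurfaceMu y) :
    0 < y * deriv rotSurfaceMu y / rotSurfaceMu y ∧
      Tendsto (fun n : ℕ => rotSurfDensity n y) atTop (𝓝 (y * deriv rotSurfaceMu y / rotSurfaceMu y)) :=
  have h := tendsto_rotSurfDensity (rotYdagger_pos.trans hy) hd
  ⟨limit_rotSurfDensity_pos_of_gt hy h, h⟩

end Literature.Probability.RandomPlanarGeometry.SAW.HV
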